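import Literature.NumberTheory.EllipticCurves.KummerSelmerStructure
import HarnessLib

/-!
# Route `AdditiveKolyvaginRoad`, crux `KolyvaginPrimitiveAdditive` (item stmt-BirchSwinnertonDyer-20132), stub LOC:
# the GENUINE local TORIC condition in the Poitou–Tate model (definition lane; toric companion of koly3b's
# `KolyvaginRoadThreeMethod2OrdinaryLocalDefs`, ordinary ↦ toric)
# (cell `pub/bsd-wall`, lead prover `bsd-wall-akr-p1` g3; `--supports stmt-BirchSwinnertonDyer-20132`)

WHY. The GLOBAL half of (Supply) for stub LOC of crux 20132 (PORT MAP in HOME/bsd-wall-akr-p1/NOTES_g3.md) is the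
unsigned ∕ signed jump of koly3b's `ZhangSupply.hjump_of_localLagrangians` at a general prime `p`, which asks above
every level prime `q ∈ AdmQ` (Bertolini–Darmon admissible) for a LOCAL condition `Ltor v ≤ H¹(K_v, E[p])` in the
Poitou–Tate model that is isotropic for the local Weil cup product, has `#Ltor v · #Ltor v = #H¹(K_v, E[p])`, and whose
preimage under the localisation lies in the additive route's GLOBAL-currency toric condition
`AdditiveKoly.toricLocalKer` (`AdditiveKolyvaginRoadLevelDefs`: localisation represented by a cocycle valued in the
augmentation subgroup `⟨τ • y − y⟩`). At `p = 3` the level condition was the ORDINARY one (fixed points; koly3b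
`Method2.ordinaryLocalCondition`); at an additive prime `p ≥ 5` the BD-admissible local picture `E[p] ≅ ℤ/p ⊕ μ_p` makes
the level condition the image of `H¹(K_q, μ_p)` = classes valued in the augmentation line `(Frob − 1) E[p]`. This file
types it: `AdditiveKoly.toricLocalCondition E L n ≤ H¹(Γ_L, E[n](K̄)|_{Γ_L})` — the local classes represented by a
continuous cocycle of the restricted module all of whose values lie in the augmentation subgroup of `Γ_L` on `E[n](K̄)`.
The dictionary with `toricLocalKer`, the isotropy (akr-p1 g2's `…ToricIsotropy`) and the count are for the companion
proof files.

HONEST FRAMING: one definition with body + its unfolding lemma; 0 named facts, 0 `sorry`, no instance, no notation;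
nothing is asserted; closes nothing.

References: [cite: BertoliniDarmon2005, §2.2–§2.3 (H¹_ord at admissible primes)] [cite: WZhang2014, §4.1 (H¹_ord)]
[cite: SerreGaloisCohomology1997, I.§5.1 (classes by cocycle representatives)].
-/

-- single-conjunct summit: `Summit.BirchSwinnertonDyer.BirchSwinnertonDyer.…` repeats the name by design
set_option linter.dupNamespace false

noncomputable section

open scoped Classical

universe u

namespace Summit.BirchSwinnertonDyer.BirchSwinnertonDyer.Theorems.AdditiveKoly

open CategoryTheory WeierstrassCurve Field Function NumberField IsDedekindDomain
open Literature.NumberTheory.EllipticCurves Literature.NumberTheory.GaloisRepresentations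

section Defs

variable {K : Type u} [Field K] (E : WeierstrassCurve K) (L : Type u) [Field L] [Algebra K L]

/-- **The GENUINE local toric condition** at a `K`-field `L` (a completion `K_v`), in the Poitou–Tate model
`H¹(Γ_L, E[n](K̄)|_{Γ_L})` (`galoisCohomology (GaloisRep.restrictField L (E.torsionGaloisModule n)) 1`, which is
`galoisCohomology ((E.torsionGaloisModule n).toLocal (Sum.inr v)) 1` for `L = K_v` by `rfl`): the local classes
represented by a continuous cocycle ALL of whose values lie in the augmentation subgroup
`⟨res τ • y − y : τ ∈ Γ_L, y ∈ E[n](K̄)⟩` — i.e. the image of `H¹(Γ_L, I_{Γ_L} E[n]) → H¹(Γ_L, E[n])`, Bertolini–Darmon's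
`H¹_ord(K_q, E[p]) = im H¹(K_q, F⁺)` at an admissible prime `q` for `p ≥ 5`, where `I_{Γ} E[p] = (Frob − 1) E[p]` is the
`μ_p`-line. Companion of the additive route's GLOBAL-currency `AdditiveKoly.toricLocalKer` (its preimage under the
localisation). A definition; nothing asserted. [cite: BertoliniDarmon2005, §2.2–§2.3 (H¹_ord)] [cite: WZhang2014, §4.1 (H¹_ord)] -/
def toricLocalCondition (n : ℤ) :
    AddSubgroup (galoisCohomology (GaloisRep.restrictField L (E.torsionGaloisModule n)) 1) where
  carrier := {a | ∃ ψ : contOneCocycles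
      (DiscreteGaloisModule.toTopRep (GaloisRep.restrictField L (E.torsionGaloisModule n))),
    (∀ σ : absoluteGaloisGroup L, (ψ.1 σ : geomTorsion E n) ∈
      AddSubgroup.closure {m : geomTorsion E n |
        ∃ (τ : absoluteGaloisGroup L) (y : geomTorsion E n), m = absGaloisRestrict K L τ • y - y}) ∧
    oneCocycleClass _ ψ = a}
  zero_mem' := ⟨0, fun _ ↦ by
    change (0 : geomTorsion E n) ∈ _
    exact AddSubgroup.zero_mem _, oneCocycleClass_zero _⟩
  add_mem' := by
    rintro a b ⟨φ, hφ, rfl⟩ ⟨ψ, hψ, rfl⟩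
    refine ⟨φ + ψ, fun σ ↦ ?_, oneCocycleClass_add _ φ ψ⟩
    change (φ.1 σ + ψ.1 σ : geomTorsion E n) ∈ _
    exact AddSubgroup.add_mem _ (hφ σ) (hψ σ)
  neg_mem' := by
    rintro a ⟨φ, hφ, rfl⟩
    refine ⟨-φ, fun σ ↦ ?_, ?_⟩
    · change (-(φ.1 σ) : geomTorsion E n) ∈ _
      exact AddSubgroup.neg_mem _ (hφ σ)
    · have h := oneCocycleClass_sub _ (0 : contOneCocycles _) φ
      rw [zero_sub, oneCocycleClass_zero, zero_sub] at h
      exact h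

variable {E L} in
/-- Membership in the genuine local toric condition (definitional). [cite: BertoliniDarmon2005, §2.2–§2.3 (H¹_ord)] -/
theorem mem_toricLocalCondition_iff {n : ℤ}
    {a : galoisCohomology (GaloisRep.restrictField L (E.torsionGaloisModule n)) 1} :
    a ∈ toricLocalCondition E L n ↔ ∃ ψ : contOneCocycles
      (DiscreteGaloisModule.toTopRep (GaloisRep.restrictField L (E.torsionGaloisModule n))),
      (∀ σ : absoluteGaloisGroup L, (ψ.1 σ : geomTorsion E n) ∈
        AddSubgroup.closure {m : geomTorsion E n |
          ∃ (τ : absoluteGaloisGroup L) (y : geomTorsion E n), m = absGaloisRestrict K L τ • y - y}) ∧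
      oneCocycleClass _ ψ = a :=
  Iff.rfl

end Defs

end Summit.BirchSwinnertonDyer.BirchSwinnertonDyer.Theorems.AdditiveKoly

end
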